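import Summits.BirchSwinnertonDyer.Rank1Residual.Additive.CyclotomicTowerSignedLocalTraceTransitive
import HarnessLib

/-!
# Kobayashi's Prop. 8.12 ii) generation half `E(K_{n,v}) = E⁺(K_{n,v}) + E⁻(K_{n,v})`, REDUCED to
# generation modulo the previous layer: membership of a norm-compatible family in `E^{(−1)^n}` from
# ONE-STEP trace relations, and the induction `hsum ⟸ (E(K_{n+1,v}) ⊆ E^{(−1)^{n+1}}(K_{n+1,v}) +
# E(K_{n,v}) ∀ n)` — cell `b2b-bsdres`, CLASS-CLOSURE lane, class O10 — x1b GEN 33, class lead;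
# file 15 of the local series (part 2 of the algebra under Prop. 8.12 ii))

HONEST FRAMING (cell `b2b-bsdres`, run/shared/lean/b2b/bsd-rank1-residual/, verbatim in every
file): the goal of the cell is to DELETE the COMBINATION-SHAPED residual classes of the
Birch–Swinnerton-Dyer formula for ALL analytic-rank `≤ 1` elliptic curves over `ℚ` — "full BSD
formula for every rank `≤ 1` curve in class `C`" assembled STRICTLY from published theorems — so
that the rank-`≤ 1` remainder becomes exactly the CONSTRUCTION-SHAPED classes, which are TYPED
(missing-input `Prop`s), NOT attempted. This is not "finishing BSD". CLASS-CLOSURE lane: prove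
what is provable now; shrink each hard class to its core with data; no claim beyond stated classes;
research routes on CONSTRUCTION-SHAPED X12 / O10; census / instrument output = EVIDENCE / conjecture
items, NEVER a Literature fact; `RESIDUAL-MAP.md` marks change only by signed lines. THIS FILE:
TOOL THEOREMS ONLY over cc-typer-6's vocabulary (`localPairTraceOfEmb`, `towerSignedLocalPointsOfEmb`)
for a GENERIC antitone tower of normal finite-index subgroups — no definition, no named Literature
fact, no Summits-side fact `def`, no `sorry`, axioms standard; nothing is booked; no label / mark /
count / sub-cell moves; O10 stays OPEN / CONSTRUCTION-SHAPED; nothing about `BSD(W, p)` of any pair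
is claimed; `hsum` itself is NOT proved here — this file isolates what its proof needs beyond pure
algebra: GENERATORS `c_n ∈ E(K_{n,v})` with `Tr_{n+2/n+1} c_{n+2} + c_n ∈ E(K_{−1,v})` whose
conjugates generate `E(K_{n,v})` modulo `E(K_{n−1,v})` ([K] Lemma 8.9 + Prop. 8.11, Honda theory —
the successor files of the series).

## What is proved (tower `U : ℕ → Subgroup Γ_K` antitone, finite index; notation of part 1)

* §3 **`C`-membership from one-step relations** `mem_towerSigned_negOnePow_of_traceRel`: a family
  `c n ∈ E(K_{n,v})` with `Tr_{1/0} c₁ ∈ E(K_{−1,v})` and `Tr_{n+2/n+1} c_{n+2} + c_n ∈ E(K_{−1,v})`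
  (Kobayashi's `Tr_{n+1/n} c_{n+1} = −c_{n−1}`, Lemma 8.9, read modulo `E(K_{−1,v})`) satisfies
  `c_n ∈ E^{(−1)^n}(K_{n,v})` for every `n` (Def. 8.10 / Prop. 8.12 i)); by a two-step induction
  on the trace transitivity of part 1.
* §4 **The reduction of `hsum`** `le_sup_towerSigned_of_forall_le_sup`: if
  `E(K_{n+1,v}) ≤ E^{(−1)^{n+1}}(K_{n+1,v}) ⊔ E(K_{n,v})` for every `n`, then
  `E(K_{n,v}) ≤ E⁺(K_{n,v}) ⊔ E⁻(K_{n,v})` for every `n` (induction from `E⁺(K_{0,v}) = E(K_{0,v})`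
  with the monotonicity of part 1) — the shape in which [K] Prop. 8.12 ii) is proved
  ("`F_ss(m_n) = C_ss(m_n) + F_ss(m_{n−1}) = C_ss(m_n) + C_ss(m_{n−1})`", p. 18); pointwise form
  `mem_sup_towerSigned_of_mem_sup`; GENERATOR form `le_sup_towerSigned_of_generators` (normal tower):
  if every `P ∈ E(K_{n+1,v})` is, modulo `E^{(−1)^{n+1}}(K_{n+1,v}) ⊔ E(K_{n,v})`, in the subgroup
  generated by the `Γ_E`-conjugates of `c_{n+1}`, then `hsum` holds at every layer.

References: [Kobayashi2003] S. Kobayashi, Invent. Math. 152 (2003), §2 p. 4, Def. 8.10, Lemma 8.9,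
Prop. 8.11, Prop. 8.12 and its proof (pp. 16–18), display (8.22).
-/

noncomputable section

open scoped Classical

universe u

namespace Summit.BirchSwinnertonDyer.Rank1Residual.Additive

open Literature.NumberTheory.EllipticCurves Literature.NumberTheory.GaloisRepresentations
  Literature.NumberTheory.EllipticCurves.Kobayashi2003

/-! ## §3 Membership of a norm-compatible family in `E^{(−1)^n}` from one-step trace relations -/

section Family

variable {K : Type u} [Field K] {E : Type u} [Field E] [Algebra K E]
  (U : ℕ → Subgroup (Field.absoluteGaloisGroup K)) [hU : ∀ n, (U n).FiniteIndex]
  (ι : AlgebraicClosure K →ₐ[K] AlgebraicClosure E) (W : WeierstrassCurve K)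

/-- **Kobayashi's norm-compatible points lie in the norm subgroups** (Def. 8.10 / Prop. 8.12 i),
from Lemma 8.9 read modulo `E(K_{−1,v})`): let `c n ∈ E(K_{n,v})` (`n ≥ 0`) satisfy
`Tr_{1/0} c₁ ∈ E(K_{−1,v})` and `Tr_{n+2/n+1} c_{n+2} + c_n ∈ E(K_{−1,v})` for all `n` (Kobayashi:
`Tr_{n+1/n} c_{n+1} = −c_{n−1}`, `c_{−1}, c_{−2} ∈ F_ss(m_{−1})`). Then `c_n ∈ E^{(−1)^n}(K_{n,v})`
for every `n`: by a two-step induction, `Tr_{n+2/m+1} c_{n+2} = Tr_{n+1/m+1}(e − c_n) =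
[·]e − [K_{n+1,v}:K_{n,v}] · Tr_{n/m+1} c_n ∈ E(K_{m,v})` for `m ≡ n (mod 2)`, `m < n` (trace
transitivity, §1), and `Tr_{n+2/n+1} c_{n+2} = e − c_n ∈ E(K_{n,v})`. Antitone tower of finite-index
subgroups; no normality, no torsion hypothesis. [cite: Kobayashi2003, Lemma 8.9, Def. 8.10, Prop. 8.12 i) (pp. 16–17)] -/
theorem mem_towerSigned_negOnePow_of_traceRel (hUa : Antitone U) (c : ℕ → localPoints W E)
    (hc : ∀ n, c n ∈ localFixedPointsOfEmb ι W (U n))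
    (h1 : localPairTraceOfEmb ι W (U 0) (U 1) (c 1) ∈ localFixedPointsOfEmb ι W ⊤)
    (hrel : ∀ n, localPairTraceOfEmb ι W (U (n + 1)) (U (n + 2)) (c (n + 2)) + c n ∈
      localFixedPointsOfEmb ι W ⊤) (n : ℕ) :
    c n ∈ towerSignedLocalPointsOfEmb U ι W ((n : ℤ).negOnePow) n := by
  -- strengthen to pairs `(n, n+1)` and induct
  suffices H : ∀ n : ℕ, c n ∈ towerSignedLocalPointsOfEmb U ι W ((n : ℤ).negOnePow) n ∧
      c (n + 1) ∈ towerSignedLocalPointsOfEmb U ι W (((n + 1 : ℕ) : ℤ).negOnePow) (n + 1) from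
    (H n).1
  intro n
  induction n with
  | zero =>
    refine ⟨?_, ?_⟩
    · -- `c₀ ∈ E⁺(K_{0,v}) = E(K_{0,v})`
      rw [show ((0 : ℕ) : ℤ).negOnePow = 1 by simp, towerSignedLocalPointsOfEmb_one_zero]
      exact hc 0
    · -- `c₁ ∈ E⁻(K_{1,v})`: no odd `m < 1`, and the `m = −1` clause is `h1`
      rw [show ((0 + 1 : ℕ) : ℤ).negOnePow = -1 by simp, mem_towerSignedLocalPointsOfEmb_neg_one_iff]
      refine ⟨hc 1, fun m hm hodd => ?_, h1⟩
      exfalso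
      have : m = 0 := by omega
      subst this
      exact (Nat.not_odd_iff_even.mpr (by decide : Even 0)) hodd
  | succ n ih =>
    refine ⟨ih.2, ?_⟩
    -- the new claim: `c (n+2) ∈ E^{(−1)^n}(K_{n+2,v})`
    have hsign : (((n + 1 + 1 : ℕ) : ℤ)).negOnePow = ((n : ℤ)).negOnePow := by
      rw [show ((n + 1 + 1 : ℕ) : ℤ) = (n : ℤ) + 2 by push_cast; ring, Int.negOnePow_add]
      simp [show (2 : ℤ).negOnePow = 1 by decide]
    rw [hsign]
    obtain ⟨hcn, -⟩ := ih
    set e := localPairTraceOfEmb ι W (U (n + 1)) (U (n + 2)) (c (n + 2)) + c n with he_def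
    have he : e ∈ localFixedPointsOfEmb ι W ⊤ := hrel n
    have hTr : localPairTraceOfEmb ι W (U (n + 1)) (U (n + 2)) (c (n + 2)) = e - c n := by
      rw [he_def]; abel
    have hcn' := hcn
    rw [mem_towerSignedLocalPointsOfEmb_iff] at hcn'
    obtain ⟨hcnU, hsgn, hneg⟩ := hcn'
    -- traces of `c (n+2)` to the layers `j ≤ n`
    have hlow : ∀ j ≤ n,
        localPairTraceOfEmb ι W (U j) (U (n + 2)) (c (n + 2)) =
          ((localSubgroupOfEmb (U (n + 1)) ι).subgroupOf (localSubgroupOfEmb (U j) ι)).index • e -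
          ((localSubgroupOfEmb (U (n + 1)) ι).subgroupOf (localSubgroupOfEmb (U n) ι)).index •
            localPairTraceOfEmb ι W (U j) (U n) (c n) := by
      intro j hj
      rw [localPairTraceOfEmb_trans ι W (hUa (show j ≤ n + 1 by omega))
          (hUa (Nat.le_succ (n + 1))) (hc (n + 2)), hTr, map_sub,
        localPairTraceOfEmb_apply_of_mem_lower ι W
          (localFixedPointsOfEmb_top_le ι W (U j) he),
        localPairTraceOfEmb_of_mem_mid U ι W hUa hj (Nat.le_succ n) hcnU]
    rw [mem_towerSignedLocalPointsOfEmb_iff]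
    refine ⟨hc (n + 2), fun m hm hε => ?_, fun hε => ?_⟩
    · rw [negOnePow_natCast_eq_iff] at hε
      rcases Nat.lt_or_ge m n with hmn | hmn
      · -- `m < n`, `m ≡ n (mod 2)`: use the induction hypothesis on `c n`
        rw [hlow (m + 1) (by omega)]
        refine sub_mem (AddSubgroup.nsmul_mem _ (localFixedPointsOfEmb_top_le ι W (U m) he) _)
          (AddSubgroup.nsmul_mem _ (hsgn m hmn ((negOnePow_natCast_eq_iff m n).mpr hε)) _)
      · -- `n ≤ m < n + 2` with the parity of `n`: `m = n`
        have hm' : m = n := by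
          rcases Nat.lt_or_ge m (n + 1) with h | h
          · omega
          · exfalso
            have : m = n + 1 := by omega
            subst this
            exact absurd (hε.mp) (fun h' => by
              rcases Nat.even_or_odd n with hn | hn
              · exact Nat.not_even_iff_odd.mpr (Even.add_one hn) (hε.mpr hn)
              · exact Nat.not_even_iff_odd.mpr hn (h' (Odd.add_one hn)))
        subst hm'
        rw [hTr]
        exact sub_mem (localFixedPointsOfEmb_top_le ι W (U m) he) hcnU
    · -- the `m = −1` clause (`n` odd): `Tr_{n+2/0} c_{n+2} = [·]e − [·]·Tr_{n/0} c_n`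
      rcases Nat.eq_zero_or_pos n with rfl | hn0
      · exfalso
        simp at hε
      · rw [hlow 0 (Nat.zero_le n)]
        exact sub_mem (AddSubgroup.nsmul_mem _ he _) (AddSubgroup.nsmul_mem _ (hneg hε) _)

end Family

/-! ## §4 The reduction of `hsum` to generation modulo the previous layer -/

section Reduction

variable {K : Type u} [Field K] {E : Type u} [Field E] [Algebra K E]
  (U : ℕ → Subgroup (Field.absoluteGaloisGroup K)) [hU : ∀ n, (U n).FiniteIndex]
  (ι : AlgebraicClosure K →ₐ[K] AlgebraicClosure E) (W : WeierstrassCurve K)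

/-- **Pointwise reduction step**: if `P ∈ E^ε(K_{n+1,v}) + E(K_{n,v})` and
`E(K_{n,v}) ≤ E⁺(K_{n,v}) ⊔ E⁻(K_{n,v})`, then `P ∈ E⁺(K_{n+1,v}) ⊔ E⁻(K_{n+1,v})` (monotonicity of
`E^±` in the layer, §2). [cite: Kobayashi2003, Prop. 8.12 ii) (proof, p. 18)] -/
theorem mem_sup_towerSigned_of_mem_sup (hUa : Antitone U) (ε : ℤˣ) (n : ℕ)
    (hsum : localFixedPointsOfEmb ι W (U n) ≤
      towerSignedLocalPointsOfEmb U ι W 1 n ⊔ towerSignedLocalPointsOfEmb U ι W (-1) n)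
    {P : localPoints W E}
    (hP : P ∈ towerSignedLocalPointsOfEmb U ι W ε (n + 1) ⊔ localFixedPointsOfEmb ι W (U n)) :
    P ∈ towerSignedLocalPointsOfEmb U ι W 1 (n + 1) ⊔ towerSignedLocalPointsOfEmb U ι W (-1) (n + 1) := by
  obtain ⟨S, hS, Q, hQ, rfl⟩ := AddSubgroup.mem_sup.mp hP
  have hQ' := hsum hQ
  obtain ⟨Qp, hQp, Qm, hQm, rfl⟩ := AddSubgroup.mem_sup.mp hQ'
  have hQp' := towerSignedLocalPointsOfEmb_mono U ι W hUa 1 (Nat.le_succ n) hQp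
  have hQm' := towerSignedLocalPointsOfEmb_mono U ι W hUa (-1) (Nat.le_succ n) hQm
  rcases Int.units_eq_one_or ε with rfl | rfl
  · have : S + (Qp + Qm) = (S + Qp) + Qm := by abel
    rw [this]
    exact AddSubgroup.add_mem_sup (add_mem hS hQp') hQm'
  · have : S + (Qp + Qm) = Qp + (S + Qm) := by abel
    rw [this]
    exact AddSubgroup.add_mem_sup hQp' (add_mem hS hQm')

/-- **[K] Prop. 8.12 ii), generation half, REDUCED to generation modulo the previous layer**: for an
antitone tower of normal finite-index subgroups, if
`E(K_{n+1,v}) ≤ E^{(−1)^{n+1}}(K_{n+1,v}) ⊔ E(K_{n,v})` for every `n` ("`F_ss(m_n) = C_ss(m_n) +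
F_ss(m_{n−1})`", Prop. 8.11 + Lemma 8.9), then **`E(K_{n,v}) ≤ E⁺(K_{n,v}) ⊔ E⁻(K_{n,v})` for every
`n`** — the hypothesis `hsum` of the (C3_η) local chain (files 5, 6, 11). Induction from
`E⁺(K_{0,v}) = E(K_{0,v})`. [cite: Kobayashi2003, Prop. 8.12 ii) (pp. 17–18, display (8.22))] -/
theorem le_sup_towerSigned_of_forall_le_sup (hUa : Antitone U)
    (hgen : ∀ n, localFixedPointsOfEmb ι W (U (n + 1)) ≤
      towerSignedLocalPointsOfEmb U ι W (((n + 1 : ℕ) : ℤ).negOnePow) (n + 1) ⊔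
        localFixedPointsOfEmb ι W (U n)) (n : ℕ) :
    localFixedPointsOfEmb ι W (U n) ≤
      towerSignedLocalPointsOfEmb U ι W 1 n ⊔ towerSignedLocalPointsOfEmb U ι W (-1) n := by
  induction n with
  | zero =>
    intro P hP
    rw [← towerSignedLocalPointsOfEmb_one_zero U ι W] at hP
    exact AddSubgroup.mem_sup_left hP
  | succ n ih =>
    intro P hP
    exact mem_sup_towerSigned_of_mem_sup U ι W hUa _ n ih (hgen n hP)

/-- The same with the generation hypothesis in Kobayashi's GENERATOR form: points `c n ∈ E(K_{n,v})`
with the one-step trace relations of §3, a set `S (n+1) ⊆ E^{(−1)^{n+1}}(K_{n+1,v})`-valued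
"span" hypothesis is not fixed here — instead the hypothesis is stated directly as: every
`P ∈ E(K_{n+1,v})` is `B + Q` with `B` in the additive subgroup generated by the `Γ_E`-conjugates of
`c (n+1)` and `Q ∈ E(K_{n,v})`. Then `hsum` holds at every layer (§2 Galois stability + §3 + the
reduction). [cite: Kobayashi2003, Prop. 8.11, Prop. 8.12 (pp. 17–18)] -/
theorem le_sup_towerSigned_of_generators (hUa : Antitone U) [hN : ∀ n, (U n).Normal]
    (c : ℕ → localPoints W E) (hc : ∀ n, c n ∈ localFixedPointsOfEmb ι W (U n))
    (h1 : localPairTraceOfEmb ι W (U 0) (U 1) (c 1) ∈ localFixedPointsOfEmb ι W ⊤)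
    (hrel : ∀ n, localPairTraceOfEmb ι W (U (n + 1)) (U (n + 2)) (c (n + 2)) + c n ∈
      localFixedPointsOfEmb ι W ⊤)
    (hgen : ∀ n, ∀ P ∈ localFixedPointsOfEmb ι W (U (n + 1)),
      ∃ B ∈ AddSubgroup.closure (Set.range fun g : Field.absoluteGaloisGroup E => g • c (n + 1)),
        P - B ∈ towerSignedLocalPointsOfEmb U ι W (((n + 1 : ℕ) : ℤ).negOnePow) (n + 1) ⊔
          localFixedPointsOfEmb ι W (U n)) (n : ℕ) :
    localFixedPointsOfEmb ι W (U n) ≤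
      towerSignedLocalPointsOfEmb U ι W 1 n ⊔ towerSignedLocalPointsOfEmb U ι W (-1) n := by
  refine le_sup_towerSigned_of_forall_le_sup U ι W hUa (fun k P hP => ?_) n
  obtain ⟨B, hB, hPB⟩ := hgen k P hP
  have hBmem : B ∈ towerSignedLocalPointsOfEmb U ι W (((k + 1 : ℕ) : ℤ).negOnePow) (k + 1) := by
    refine (AddSubgroup.closure_le _).mpr ?_ hB
    rintro _ ⟨g, rfl⟩
    exact smul_mem_towerSignedLocalPointsOfEmb U ι W _ (k + 1) g
      (mem_towerSigned_negOnePow_of_traceRel U ι W hUa c hc h1 hrel (k + 1))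
  have : P = B + (P - B) := by abel
  rw [this]
  exact add_mem (AddSubgroup.mem_sup_left hBmem) hPB

end Reduction

end Summit.BirchSwinnertonDyer.Rank1Residual.Additive

end
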